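import Mathlib.CategoryTheory.Limits.Shapes.Pullback.HasPullback
import Mathlib.CategoryTheory.Limits.Constructions.BinaryProducts
import Mathlib.CategoryTheory.Limits.Preserves.Shapes.Pullbacks
import Mathlib.CategoryTheory.Limits.Preserves.Shapes.BinaryProducts
import Literature.AnabelianGeometry.SemiGraphs.NotationsConventions
import HarnessLib

/-!
# Semi-graphs of anabelioids, Appendix: the Čech pair of `A ⨯ X → X` inside `C[A]`

Mochizuki, *Semi-graphs of anabelioids*, Publ. RIMS **42** (2006) 221–322, Appendix, proof of Theorem A.4
(manuscript pp. 85–86, PRIMS pp. 315–316) [cite: MochizukiSemiAnbd2006, Thm A.4 proof pp.85-86].  The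
existence half of Thm. A.4 extends a functor given on `Q = T[A] ⊆ T` to all of `T`; every object `X` of
`T` is presented by objects of `T[A]`: the Čech pair
`q₁, q₂ : A ⨯ (A ⨯ X) ⇉ A ⨯ X` (forgetting the outer / inner factor) with augmentation `A ⨯ X → X` —
the presentation already used by the uniqueness clause (`QuasiTemperoidsThmA4Unique.lean`).  This file
records that pair as data of the FULL SUBCATEGORY `C[A] = Over' A` (everything admits an arrow to `A`
through a projection), for any category `C` with binary products, together with the finite-limit
bookkeeping the Čech-extension route to Thm. A.4 consumes (row A4-∃ of the abc-iut cell's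
`plan/L3/SUBDAG-SemiAnbd-Cor311.md`; CONVENTION: `A` on the LEFT):

* functors `cechZero A : C ⥤ C[A]` (`X ↦ A ⨯ X`), `cechOne A` (`X ↦ A ⨯ (A ⨯ X)`), the faces
  `cechFst`/`cechSnd` (natural transformations), the degeneracy `cechDiag`, the symmetry `cechSwap`,
  the pairing `cechPairing : X₁ → X₀ ⨯ X₀` (a monomorphism, `mono_cechPairing`; the product
  `cechPairObj` with `cechPairIsLimit`), the composition object `cechTwo X = X₁ ×_{X₀} X₁` with
  `cechComp : X₂ → X₁` (`cechTwoIsLimit`, `cechComp_fst/snd`) — so that "`K(q₁) w ~ K(q₂) w`" is an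
  equivalence relation after applying a fibre-product-preserving `K`;
* folklore limit lemmas about `A ⨯ (−)`: the naturality square of `A ⨯ U → U` is a pullback
  (`nonempty_isLimitPullbackConeSndProdMap`: `X₁ ≅ X₀ ×_{Z₀} Z₁` along `q₁`), `A ⨯ (−)` preserves
  fibre products (`nonempty_isLimitPullbackConeProdMap`), and for `X` terminal `(q₁, q₂)` exhibits `X₁`
  as `X₀ ⨯ X₀` (`nonempty_isLimitBinaryFanCechOfIsTerminal`) and `X₀ ≅ A` (`cechZeroIsoOfIsTerminal`).

The mirror convention (`X ⨯ A`, faces `prod.fst`, `prod.map prod.fst (𝟙 A)`) is abc-iut-w4-d048's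
`CechNerveSquares.lean`; the two files are independent.  Pure category theory; nothing refers to the IUT
corpus and no side is taken on any disputed claim.
-/

open CategoryTheory CategoryTheory.Limits

namespace Literature.AnabelianGeometry.SemiGraphs

universe v u

/-! ### Monomorphisms of `C[A]` -/

section OverPrimeMono

variable {C : Type u} [Category.{v} C] (A : C)

/-- A morphism of `C[A]` whose underlying arrow is a monomorphism is a monomorphism (the inclusion is
faithful). [cite: MochizukiSemiAnbd2006, §0 p.6] -/
theorem overPrime_mono_of_mono_hom {X Y : Over' A} (f : X ⟶ Y) [Mono f.hom] : Mono f :=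
  (admitsHomTo A).ι.mono_of_mono_map (by simpa using (inferInstance : Mono f.hom))

end OverPrimeMono

/-! ### The Čech pair of `A ⨯ X ↠ X` -/

section Cech

variable {C : Type u} [Category.{v} C] [HasBinaryProducts C] (A : C)

/-- `X ↦ A ⨯ X` as an object of `C[A]` (via the first projection): degree 0 of the Čech nerve of
`A ⨯ X → X` — the presentation of an arbitrary object of `T` by objects of `T[A]` used in the proof
of Thm. A.4. [cite: MochizukiSemiAnbd2006, Thm A.4 proof pp.85-86] -/
noncomputable def cechZero : C ⥤ Over' A where
  obj X := ⟨A ⨯ X, ⟨prod.fst⟩⟩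
  map f := ObjectProperty.homMk (prod.map (𝟙 A) f)
  map_id X := ObjectProperty.hom_ext _ (by simp)
  map_comp f g := ObjectProperty.hom_ext _ (by simp)

/-- `X ↦ A ⨯ (A ⨯ X)` as an object of `C[A]`: degree 1 of the Čech nerve of `A ⨯ X → X`.
[cite: MochizukiSemiAnbd2006, Thm A.4 proof pp.85-86] -/
noncomputable def cechOne : C ⥤ Over' A where
  obj X := ⟨A ⨯ (A ⨯ X), ⟨prod.fst⟩⟩
  map f := ObjectProperty.homMk (prod.map (𝟙 A) (prod.map (𝟙 A) f))
  map_id X := ObjectProperty.hom_ext _ (by simp)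
  map_comp f g := ObjectProperty.hom_ext _ (by simp)

/-- Underlying object of `cechZero`. [cite: MochizukiSemiAnbd2006, Thm A.4 proof pp.85-86] -/
@[simp] theorem cechZero_obj_obj (X : C) : ((cechZero A).obj X).obj = (A ⨯ X) := rfl

/-- Underlying object of `cechOne`. [cite: MochizukiSemiAnbd2006, Thm A.4 proof pp.85-86] -/
@[simp] theorem cechOne_obj_obj (X : C) : ((cechOne A).obj X).obj = (A ⨯ (A ⨯ X)) := rfl

/-- Underlying arrow of `cechZero` on morphisms. [cite: MochizukiSemiAnbd2006, Thm A.4 proof pp.85-86] -/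
@[simp] theorem cechZero_map_hom {X Y : C} (f : X ⟶ Y) :
    ((cechZero A).map f).hom = prod.map (𝟙 A) f := rfl

/-- Underlying arrow of `cechOne` on morphisms. [cite: MochizukiSemiAnbd2006, Thm A.4 proof pp.85-86] -/
@[simp] theorem cechOne_map_hom {X Y : C} (f : X ⟶ Y) :
    ((cechOne A).map f).hom = prod.map (𝟙 A) (prod.map (𝟙 A) f) := rfl

/-- `cechZero ⋙ ι = A ⨯ (−)`. [cite: MochizukiSemiAnbd2006, Thm A.4 proof pp.85-86] -/
noncomputable def cechZeroCompιIso : cechZero A ⋙ (admitsHomTo A).ι ≅ prod.functor.obj A := Iso.refl _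

/-- `cechOne ⋙ ι = A ⨯ (A ⨯ (−))`. [cite: MochizukiSemiAnbd2006, Thm A.4 proof pp.85-86] -/
noncomputable def cechOneCompιIso :
    cechOne A ⋙ (admitsHomTo A).ι ≅ prod.functor.obj A ⋙ prod.functor.obj A := Iso.refl _

/-- First face `q₁ : A ⨯ (A ⨯ X) → A ⨯ X`, forgetting the OUTER factor `A`.
[cite: MochizukiSemiAnbd2006, Thm A.4 proof pp.85-86] -/
noncomputable def cechFst : cechOne A ⟶ cechZero A where
  app X := ObjectProperty.homMk (prod.snd : A ⨯ (A ⨯ X) ⟶ A ⨯ X)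
  naturality X Y f := ObjectProperty.hom_ext _ (by simp)

/-- Second face `q₂ : A ⨯ (A ⨯ X) → A ⨯ X`, forgetting the INNER factor `A`.
[cite: MochizukiSemiAnbd2006, Thm A.4 proof pp.85-86] -/
noncomputable def cechSnd : cechOne A ⟶ cechZero A where
  app X := ObjectProperty.homMk (prod.map (𝟙 A) (prod.snd : A ⨯ X ⟶ X))
  naturality X Y f := ObjectProperty.hom_ext _ (by simp)

/-- Underlying arrow of `q₁`. [cite: MochizukiSemiAnbd2006, Thm A.4 proof pp.85-86] -/
@[simp] theorem cechFst_app_hom (X : C) :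
    ((cechFst A).app X).hom = (prod.snd : A ⨯ (A ⨯ X) ⟶ A ⨯ X) := rfl

/-- Underlying arrow of `q₂`. [cite: MochizukiSemiAnbd2006, Thm A.4 proof pp.85-86] -/
@[simp] theorem cechSnd_app_hom (X : C) :
    ((cechSnd A).app X).hom = prod.map (𝟙 A) (prod.snd : A ⨯ X ⟶ X) := rfl

/-- The augmentation `p : A ⨯ X → X` coequalises the two faces: `q₁ ≫ p = q₂ ≫ p`.
[cite: MochizukiSemiAnbd2006, Thm A.4 proof pp.85-86] -/
@[reassoc] theorem cechFst_snd (X : C) :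
    ((cechFst A).app X).hom ≫ (prod.snd : A ⨯ X ⟶ X) = ((cechSnd A).app X).hom ≫ prod.snd := by
  simp

/-- The augmentation is natural: `(A ⨯ f) ≫ p = p ≫ f`. [cite: MochizukiSemiAnbd2006, Thm A.4 proof pp.85-86] -/
@[reassoc] theorem cechZero_map_snd {X Y : C} (f : X ⟶ Y) :
    ((cechZero A).map f).hom ≫ (prod.snd : A ⨯ Y ⟶ Y) = prod.snd ≫ f := by
  simp

/-- The degeneracy `δ : A ⨯ X → A ⨯ (A ⨯ X)`, `(a, x) ↦ (a, (a, x))`, as an arrow of `C[A]`.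
[cite: MochizukiSemiAnbd2006, Thm A.4 proof pp.85-86] -/
noncomputable def cechDiag (X : C) : (cechZero A).obj X ⟶ (cechOne A).obj X :=
  ObjectProperty.homMk (prod.lift prod.fst (𝟙 (A ⨯ X)))

/-- The symmetry `σ : A ⨯ (A ⨯ X) → A ⨯ (A ⨯ X)`, `(a, (b, x)) ↦ (b, (a, x))`, as an arrow of `C[A]`.
[cite: MochizukiSemiAnbd2006, Thm A.4 proof pp.85-86] -/
noncomputable def cechSwap (X : C) : (cechOne A).obj X ⟶ (cechOne A).obj X :=
  ObjectProperty.homMk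
    (prod.lift (prod.snd ≫ prod.fst) (prod.map (𝟙 A) (prod.snd : A ⨯ X ⟶ X)))

/-- `δ ≫ q₁ = 𝟙`. [cite: MochizukiSemiAnbd2006, Thm A.4 proof pp.85-86] -/
@[reassoc (attr := simp)] theorem cechDiag_fst (X : C) :
    cechDiag A X ≫ (cechFst A).app X = 𝟙 _ :=
  ObjectProperty.hom_ext _ (by simp [cechDiag, prod.lift_snd])

/-- `δ ≫ q₂ = 𝟙`. [cite: MochizukiSemiAnbd2006, Thm A.4 proof pp.85-86] -/
@[reassoc (attr := simp)] theorem cechDiag_snd (X : C) :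
    cechDiag A X ≫ (cechSnd A).app X = 𝟙 _ := by
  apply ObjectProperty.hom_ext
  simp only [cechDiag, ObjectProperty.FullSubcategory.comp_hom, ObjectProperty.homMk_hom,
    cechSnd_app_hom, ObjectProperty.FullSubcategory.id_hom]
  apply Limits.prod.hom_ext
  · simp
  · simp

/-- `σ ≫ q₁ = q₂`. [cite: MochizukiSemiAnbd2006, Thm A.4 proof pp.85-86] -/
@[reassoc (attr := simp)] theorem cechSwap_fst (X : C) :
    cechSwap A X ≫ (cechFst A).app X = (cechSnd A).app X :=
  ObjectProperty.hom_ext _ (by simp [cechSwap, prod.lift_snd])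

/-- `σ ≫ q₂ = q₁`. [cite: MochizukiSemiAnbd2006, Thm A.4 proof pp.85-86] -/
@[reassoc (attr := simp)] theorem cechSwap_snd (X : C) :
    cechSwap A X ≫ (cechSnd A).app X = (cechFst A).app X := by
  apply ObjectProperty.hom_ext
  simp only [cechSwap, ObjectProperty.FullSubcategory.comp_hom, ObjectProperty.homMk_hom,
    cechSnd_app_hom, cechFst_app_hom]
  apply Limits.prod.hom_ext
  · simp [prod.lift_fst]
  · simp [prod.lift_snd]

/-- The pair `(q₁, q₂)` is jointly monic: an arrow into `A ⨯ (A ⨯ X)` is determined by its two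
composites with the faces. [cite: MochizukiSemiAnbd2006, Thm A.4 proof pp.85-86] -/
theorem cech_hom_ext {X W : C} {u v : W ⟶ A ⨯ (A ⨯ X)}
    (h₁ : u ≫ ((cechFst A).app X).hom = v ≫ ((cechFst A).app X).hom)
    (h₂ : u ≫ ((cechSnd A).app X).hom = v ≫ ((cechSnd A).app X).hom) : u = v := by
  apply Limits.prod.hom_ext
  · have e := h₂ =≫ (prod.fst : A ⨯ X ⟶ A)
    simp only [cechZero_obj_obj, Category.assoc, cechSnd_app_hom, prod.map_fst,
      Category.comp_id] at e
    exact e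
  · simpa using h₁

/-! #### Limit lemmas for the Čech pair (stated on underlying arrows of `C`) -/

/-- For `g : U → V`, the naturality square of the projection `A ⨯ (−) → (−)` at `g` is a pullback:
`A ⨯ U ≅ U ×_V (A ⨯ V)`. (For `g = A ⨯ f` this says `X₁ ≅ X₀ ×_{Z₀} Z₁` along `q₁`; step of the proof of
Thm. A.4.) [cite: MochizukiSemiAnbd2006, Thm A.4 proof pp.85-86] -/
theorem nonempty_isLimitPullbackConeSndProdMap {U V : C} (g : U ⟶ V) :
    Nonempty (IsLimit (PullbackCone.mk (prod.snd : A ⨯ U ⟶ U) (prod.map (𝟙 A) g) (by simp) :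
      PullbackCone g (prod.snd : A ⨯ V ⟶ V))) :=
  ⟨PullbackCone.IsLimit.mk _ (fun s => prod.lift (s.snd ≫ prod.fst) s.fst)
    (fun s => by simp [prod.lift_snd])
    (fun s => by
      apply Limits.prod.hom_ext
      · simp [prod.lift_fst]
      · simpa [prod.lift_snd] using s.condition)
    (fun s m h₁ h₂ => by
      apply Limits.prod.hom_ext
      · have e := h₂ =≫ prod.fst
        simp only [Category.assoc, prod.map_fst, Category.comp_id] at e
        simp [prod.lift_fst, e]
      · simpa [prod.lift_snd] using h₁)⟩

/-- `A ⨯ (−)` preserves fibre products: if `X ← P → Y` is a pullback of `X → Z ← Y`, then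
`A ⨯ X ← A ⨯ P → A ⨯ Y` is a pullback of `A ⨯ X → A ⨯ Z ← A ⨯ Y` (step of the proof of Thm. A.4: `P₀`, `P₁`
are fibre products of the nerves). [cite: MochizukiSemiAnbd2006, Thm A.4 proof pp.85-86] -/
theorem nonempty_isLimitPullbackConeProdMap {P X Y Z : C} {f : X ⟶ Z} {g : Y ⟶ Z} {π₁ : P ⟶ X}
    {π₂ : P ⟶ Y} {comm : π₁ ≫ f = π₂ ≫ g} (hP : IsLimit (PullbackCone.mk π₁ π₂ comm)) :
    Nonempty (IsLimit (PullbackCone.mk (prod.map (𝟙 A) π₁) (prod.map (𝟙 A) π₂)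
      (by rw [prod.map_map, prod.map_map, comm]) :
      PullbackCone (prod.map (𝟙 A) f) (prod.map (𝟙 A) g))) := by
  have hcond : ∀ s : PullbackCone (prod.map (𝟙 A) f) (prod.map (𝟙 A) g),
      (s.fst ≫ prod.snd) ≫ f = (s.snd ≫ prod.snd) ≫ g := fun s => by
    have e := s.condition =≫ prod.snd
    simpa only [Category.assoc, prod.map_snd] using e
  have hfst : ∀ s : PullbackCone (prod.map (𝟙 A) f) (prod.map (𝟙 A) g),
      s.fst ≫ prod.fst = s.snd ≫ prod.fst := fun s => by
    have e := s.condition =≫ prod.fst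
    simpa only [Category.assoc, prod.map_fst, Category.comp_id] using e
  refine ⟨PullbackCone.IsLimit.mk _
    (fun s => prod.lift (s.fst ≫ prod.fst)
      (PullbackCone.IsLimit.lift hP (s.fst ≫ prod.snd) (s.snd ≫ prod.snd) (hcond s)))
    (fun s => ?_) (fun s => ?_) (fun s m h₁ h₂ => ?_)⟩
  · apply Limits.prod.hom_ext
    · simp [prod.lift_fst]
    · rw [Category.assoc, prod.map_snd, prod.lift_snd_assoc]
      exact PullbackCone.IsLimit.lift_fst hP _ _ _
  · apply Limits.prod.hom_ext
    · simp [prod.lift_fst, hfst s]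
    · rw [Category.assoc, prod.map_snd, prod.lift_snd_assoc]
      exact PullbackCone.IsLimit.lift_snd hP _ _ _
  · apply Limits.prod.hom_ext
    · have e := h₁ =≫ prod.fst
      simp only [Category.assoc, prod.map_fst, Category.comp_id] at e
      simp [prod.lift_fst, e]
    · rw [prod.lift_snd]
      apply PullbackCone.IsLimit.hom_ext hP
      · change (m ≫ prod.snd) ≫ π₁ =
          (PullbackCone.IsLimit.lift hP (s.fst ≫ prod.snd) (s.snd ≫ prod.snd) (hcond s) : s.pt ⟶ P) ≫ π₁
        have e := h₁ =≫ prod.snd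
        simp only [Category.assoc, prod.map_snd] at e
        rw [Category.assoc, e]
        exact (PullbackCone.IsLimit.lift_fst hP _ _ _).symm
      · change (m ≫ prod.snd) ≫ π₂ =
          (PullbackCone.IsLimit.lift hP (s.fst ≫ prod.snd) (s.snd ≫ prod.snd) (hcond s) : s.pt ⟶ P) ≫ π₂
        have e := h₂ =≫ prod.snd
        simp only [Category.assoc, prod.map_snd] at e
        rw [Category.assoc, e]
        exact (PullbackCone.IsLimit.lift_snd hP _ _ _).symm

/-- When `X` is terminal, `A ⨯ (A ⨯ X)` with the two faces `(q₁, q₂)` is a product of `A ⨯ X` with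
itself (a pullback over a terminal object is a product; step of the proof of Thm. A.4, terminal objects).
[cite: MochizukiSemiAnbd2006, Thm A.4 proof pp.85-86] -/
theorem nonempty_isLimitBinaryFanCechOfIsTerminal {X : C} (hX : IsTerminal X) :
    Nonempty (IsLimit (BinaryFan.mk (prod.snd : A ⨯ (A ⨯ X) ⟶ A ⨯ X)
      (prod.map (𝟙 A) (prod.snd : A ⨯ X ⟶ X)))) :=
  ⟨isProductOfIsTerminalIsPullback _ _ _ _ hX
    (nonempty_isLimitPullbackConeSndProdMap A (prod.snd : A ⨯ X ⟶ X)).some⟩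

/-- When `X` is terminal, `A ⨯ X ≅ A` in `C[A]` (via the first projection; step of the proof of Thm. A.4).
[cite: MochizukiSemiAnbd2006, Thm A.4 proof pp.85-86] -/
noncomputable def cechZeroIsoOfIsTerminal {X : C} (hX : IsTerminal X) :
    (cechZero A).obj X ≅ ⟨A, ⟨𝟙 A⟩⟩ where
  hom := ObjectProperty.homMk (prod.fst : A ⨯ X ⟶ A)
  inv := ObjectProperty.homMk (prod.lift (𝟙 A) (hX.from A) : A ⟶ A ⨯ X)
  hom_inv_id := ObjectProperty.hom_ext _ (by
    change (prod.fst : A ⨯ X ⟶ A) ≫ prod.lift (𝟙 A) (hX.from A) = 𝟙 (A ⨯ X)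
    apply Limits.prod.hom_ext
    · simp [prod.lift_fst]
    · simpa [prod.lift_snd] using hX.hom_ext _ _)
  inv_hom_id := ObjectProperty.hom_ext _ (by
    change prod.lift (𝟙 A) (hX.from A) ≫ (prod.fst : A ⨯ X ⟶ A) = 𝟙 A
    simp [prod.lift_fst])

/-! #### The pairing `(q₁, q₂) : X₁ → X₀ ⨯ X₀` inside `C[A]` -/

/-- `X₀ ⨯ X₀ = (A ⨯ X) ⨯ (A ⨯ X)` as an object of `C[A]`. [cite: MochizukiSemiAnbd2006, Thm A.4 proof pp.85-86] -/
noncomputable def cechPairObj (X : C) : Over' A :=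
  ⟨(A ⨯ X) ⨯ (A ⨯ X), ⟨prod.fst ≫ prod.fst⟩⟩

/-- Underlying object of `X₀ ⨯ X₀`. [cite: MochizukiSemiAnbd2006, Thm A.4 proof pp.85-86] -/
@[simp] theorem cechPairObj_obj (X : C) : (cechPairObj A X).obj = ((A ⨯ X) ⨯ (A ⨯ X)) := rfl

/-- First projection `X₀ ⨯ X₀ → X₀`. [cite: MochizukiSemiAnbd2006, Thm A.4 proof pp.85-86] -/
noncomputable def cechPairFst (X : C) : cechPairObj A X ⟶ (cechZero A).obj X :=
  ObjectProperty.homMk (prod.fst : (A ⨯ X) ⨯ (A ⨯ X) ⟶ A ⨯ X)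

/-- Second projection `X₀ ⨯ X₀ → X₀`. [cite: MochizukiSemiAnbd2006, Thm A.4 proof pp.85-86] -/
noncomputable def cechPairSnd (X : C) : cechPairObj A X ⟶ (cechZero A).obj X :=
  ObjectProperty.homMk (prod.snd : (A ⨯ X) ⨯ (A ⨯ X) ⟶ A ⨯ X)

/-- The pairing `(q₁, q₂) : X₁ → X₀ ⨯ X₀`. [cite: MochizukiSemiAnbd2006, Thm A.4 proof pp.85-86] -/
noncomputable def cechPairing (X : C) : (cechOne A).obj X ⟶ cechPairObj A X :=
  ObjectProperty.homMk (prod.lift ((cechFst A).app X).hom ((cechSnd A).app X).hom)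

/-- `(q₁, q₂) ≫ pr₁ = q₁`. [cite: MochizukiSemiAnbd2006, Thm A.4 proof pp.85-86] -/
@[reassoc (attr := simp)] theorem cechPairing_fst (X : C) :
    cechPairing A X ≫ cechPairFst A X = (cechFst A).app X :=
  ObjectProperty.hom_ext _ (prod.lift_fst _ _)

/-- `(q₁, q₂) ≫ pr₂ = q₂`. [cite: MochizukiSemiAnbd2006, Thm A.4 proof pp.85-86] -/
@[reassoc (attr := simp)] theorem cechPairing_snd (X : C) :
    cechPairing A X ≫ cechPairSnd A X = (cechSnd A).app X :=
  ObjectProperty.hom_ext _ (prod.lift_snd _ _)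

/-- Underlying arrow of the pairing. [cite: MochizukiSemiAnbd2006, Thm A.4 proof pp.85-86] -/
@[simp] theorem cechPairing_hom (X : C) :
    (cechPairing A X).hom = prod.lift ((cechFst A).app X).hom ((cechSnd A).app X).hom := rfl

/-- The pairing `(q₁, q₂)` is a monomorphism of `C[A]`. [cite: MochizukiSemiAnbd2006, Thm A.4 proof pp.85-86] -/
theorem mono_cechPairing (X : C) : Mono (cechPairing A X) := by
  haveI : Mono (cechPairing A X).hom := ⟨fun u v h => by
    rw [cechPairing_hom] at h
    exact cech_hom_ext A
      (by simpa only [cechPairObj_obj, cechOne_obj_obj, cechZero_obj_obj, Category.assoc, prod.lift_fst]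
        using h =≫ prod.fst)
      (by simpa only [cechPairObj_obj, cechOne_obj_obj, cechZero_obj_obj, Category.assoc, prod.lift_snd]
        using h =≫ prod.snd)⟩
  exact overPrime_mono_of_mono_hom A _

/-- `X₀ ⨯ X₀` with its projections is a binary product in `C[A]` (reflected from `C`).
[cite: MochizukiSemiAnbd2006, Thm A.4 proof pp.85-86] -/
noncomputable def cechPairIsLimit (X : C) : IsLimit (BinaryFan.mk (cechPairFst A X) (cechPairSnd A X)) :=
  isLimitOfReflects (admitsHomTo A).ι
    ((isLimitMapConeBinaryFanEquiv (admitsHomTo A).ι _ _).symm (prodIsProd (A ⨯ X) (A ⨯ X)))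

/-! #### The composition object `X₂ = X₁ ×_{X₀} X₁` (for transitivity) -/

variable [HasPullbacks C]

/-- `X₂ := X₁ ×_{q₂, X₀, q₁} X₁` as an object of `C[A]`: pairs of 1-simplices sharing a face.
[cite: MochizukiSemiAnbd2006, Thm A.4 proof pp.85-86] -/
noncomputable def cechTwo (X : C) : Over' A :=
  ⟨pullback ((cechSnd A).app X).hom ((cechFst A).app X).hom,
    ⟨pullback.fst _ _ ≫ (prod.fst : A ⨯ (A ⨯ X) ⟶ A)⟩⟩

/-- Underlying object of `X₂`. [cite: MochizukiSemiAnbd2006, Thm A.4 proof pp.85-86] -/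
@[simp] theorem cechTwo_obj (X : C) :
    (cechTwo A X).obj = pullback ((cechSnd A).app X).hom ((cechFst A).app X).hom := rfl

/-- First projection `X₂ → X₁`. [cite: MochizukiSemiAnbd2006, Thm A.4 proof pp.85-86] -/
noncomputable def cechTwoFst (X : C) : cechTwo A X ⟶ (cechOne A).obj X :=
  ObjectProperty.homMk (pullback.fst _ _)

/-- Second projection `X₂ → X₁`. [cite: MochizukiSemiAnbd2006, Thm A.4 proof pp.85-86] -/
noncomputable def cechTwoSnd (X : C) : cechTwo A X ⟶ (cechOne A).obj X :=
  ObjectProperty.homMk (pullback.snd _ _)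

/-- Underlying arrow of the first projection. [cite: MochizukiSemiAnbd2006, Thm A.4 proof pp.85-86] -/
@[simp] theorem cechTwoFst_hom (X : C) : (cechTwoFst A X).hom = pullback.fst _ _ := rfl

/-- Underlying arrow of the second projection. [cite: MochizukiSemiAnbd2006, Thm A.4 proof pp.85-86] -/
@[simp] theorem cechTwoSnd_hom (X : C) : (cechTwoSnd A X).hom = pullback.snd _ _ := rfl

/-- The defining square of `X₂`. [cite: MochizukiSemiAnbd2006, Thm A.4 proof pp.85-86] -/
@[reassoc] theorem cechTwo_condition (X : C) :
    cechTwoFst A X ≫ (cechSnd A).app X = cechTwoSnd A X ≫ (cechFst A).app X :=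
  ObjectProperty.hom_ext _ pullback.condition

/-- `X₂` with its projections is a fibre product in `C[A]` (reflected from `C`).
[cite: MochizukiSemiAnbd2006, Thm A.4 proof pp.85-86] -/
noncomputable def cechTwoIsLimit (X : C) :
    IsLimit (PullbackCone.mk (cechTwoFst A X) (cechTwoSnd A X) (cechTwo_condition A X)) :=
  isLimitOfIsLimitPullbackConeMap (admitsHomTo A).ι _
    (pullbackIsPullback ((cechSnd A).app X).hom ((cechFst A).app X).hom)

/-- The composition `X₂ → X₁`, `((a,(b,x)), (a′,(a,x))) ↦ (a′,(b,x))`.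
[cite: MochizukiSemiAnbd2006, Thm A.4 proof pp.85-86] -/
noncomputable def cechComp (X : C) : cechTwo A X ⟶ (cechOne A).obj X :=
  ObjectProperty.homMk (prod.lift (pullback.snd _ _ ≫ prod.fst) (pullback.fst _ _ ≫ prod.snd))

/-- The composition has the first face of the first simplex: `c ≫ q₁ = pr₁ ≫ q₁`.
[cite: MochizukiSemiAnbd2006, Thm A.4 proof pp.85-86] -/
@[reassoc] theorem cechComp_fst (X : C) :
    cechComp A X ≫ (cechFst A).app X = cechTwoFst A X ≫ (cechFst A).app X :=
  ObjectProperty.hom_ext _ (by simp [cechComp, cechTwoFst, prod.lift_snd])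

/-- The composition has the second face of the second simplex: `c ≫ q₂ = pr₂ ≫ q₂`.
[cite: MochizukiSemiAnbd2006, Thm A.4 proof pp.85-86] -/
@[reassoc] theorem cechComp_snd (X : C) :
    cechComp A X ≫ (cechSnd A).app X = cechTwoSnd A X ≫ (cechSnd A).app X := by
  apply ObjectProperty.hom_ext
  simp only [cechComp, cechTwoSnd, ObjectProperty.FullSubcategory.comp_hom, ObjectProperty.homMk_hom,
    cechSnd_app_hom, cechOne_obj_obj, cechZero_obj_obj]
  apply Limits.prod.hom_ext
  · simp [prod.lift_fst]
  · have e := (pullback.condition (f := ((cechSnd A).app X).hom) (g := ((cechFst A).app X).hom)) =≫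
      (prod.snd : A ⨯ X ⟶ X)
    simp only [cechZero_obj_obj, cechOne_obj_obj, cechSnd_app_hom, cechFst_app_hom, Category.assoc,
      prod.map_snd] at e
    simp only [cechTwo_obj, cechZero_obj_obj, cechOne_obj_obj, cechSnd_app_hom, cechFst_app_hom,
      Category.assoc, prod.map_snd, prod.lift_snd_assoc]
    exact e

end Cech

end Literature.AnabelianGeometry.SemiGraphs
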